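import Mathlib
import Summits.ValiantsHypothesis.ValiantsHypothesis.Theorems.BarrierLeverNaturalProofsSeparateVNPLinearRange
import Summits.ValiantsHypothesis.ValiantsHypothesis.Theorems.BarrierLeverDefinableEquationsPartialDerivativeWallOrderOneBinomial

/-!
# Route BarrierLever — crux `DefinableEquations` (stmt-8745) / item `SingleSizeEquations`
# (stmt-8749): the DEGREE METHOD (Baur–Strassen × Macaulay, item 20156's certificates) is walled
# INSIDE THE OPEN RUNG `SmallCircuits ℂ n 2` (val-np-p5 g14)

The cell's size-axis natural proof (item 20156 `NaturalProofsAgainstAllLinearSizes`; files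
`…NaturalProofsAgainstAllLinearSizes*`) is the family of coordinate-restricted Macaulay determinants
`certPoly n k` (`k ≤ n` restricted variables): FSV-natural of level `84c+39` against every LINEAR size
`c·n`.  Its nonvanishing witness — recorded at the point by val-np-p4
(`NaturalProofsSeparateVNP.LinearRange.eval_certPoly_fermat`: value `1` at the padded Fermat
polynomial `F_{n,k} = Σ_{i<k} x_i^n / n`) — was placed in `SmallCircuits ℂ n 3` (`x^n` by `n`
products).  With BINARY POWERING (`PartialDerivativeWall.complexity_pow_le_add_two_mul_log`,
val-np-p5 g12) the witness costs `≤ k(2⌊log₂ n⌋ + 2) ≤ n²` gates for `n ≥ 6`, so: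

* `complexity_fermat_le_log`, `fermat_mem_smallCircuits_two` — `F_{n,k} ∈ SmallCircuits ℂ n 2`
  (`n ≥ 6`, `k ≤ n`);
* **`certPoly_not_vanish_smallCircuits_two`** — for every `n ≥ 6`, `k ≤ n`, `b ≥ 2` the certificate
  `certPoly n k` does NOT vanish on `SmallCircuits ℂ n b`; `not_isNaturalProof_certPoly_two` — it is
  not an `IsNaturalProof` against `SmallCircuits ℂ n b`, `b ≥ 2`, in ANY distinguisher class;
* `no_degreeCertificate_smallCircuits_two` — no polynomial in the coefficient variables that is
  nonzero wherever some `certPoly n k` (`k ≤ n`) is nonzero vanishes on `SmallCircuits ℂ n b`, `b ≥ 2`;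
* `naturalProofsSeparate_linearSize_vp_two` — val-np-p4's linear-range statement of item 18972 with
  the non-root now in `SmallCircuits ℂ n 2` (was `3`).

Chart line (method-wall axis): DEGREE method — natural proofs against every linear size `c·n`
(20156, level `84c+39`) — WALL at size `n(2⌊log₂ n⌋+2)`, inside `b = 2` (this file; the method's
ceiling `Θ(n log n)` is Baur–Strassen's, here in the kernel for the tree's certificate family).  What
this is NOT: nothing on the crux (`b = 2` OPEN, Chatterjee–Tengse §1.3 dir. 2) or on `VP ≠ VNP`; no
definitions, no named facts, standard axioms.  Refs: Baur–Strassen 1983; Cox–Little–O'Shea 2005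
Ch. 3 §4; Forbes–Shpilka–Volk 2018 Def. 1; Bürgisser 2000 §2.1.
-/

-- `Summit.ValiantsHypothesis.ValiantsHypothesis.…` repeats a component by the D-0017 layout
-- (single-conjunct summit), which the `dupNamespace` linter flags; the name is mandated.
set_option linter.dupNamespace false

noncomputable section

namespace Summit.ValiantsHypothesis.ValiantsHypothesis.Theorems.BarrierLeverDefinableEquations

open MvPolynomial
open Literature.Computability.AlgebraicComplexity
open Literature.Barriers.ValiantsHypothesis
open Summit.ValiantsHypothesis.ValiantsHypothesis.Theorems.BarrierLever.NaturalProofsAgainstAllLinearSizes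
open Summit.ValiantsHypothesis.ValiantsHypothesis.Theorems.BarrierLever.NaturalProofsSeparateVNP.LinearRange
open scoped BigOperators

namespace DegreeMethodWall

/-! ## §1 The padded Fermat polynomial by binary powering -/

/-- `L(Σ_{i<k} c·x_i^n) ≤ k (2⌊log₂ n⌋ + 2)`: each power by repeated squaring (`2⌊log₂ n⌋`), one
scalar multiplication, one addition per summand. [cite: Burgisser2000, §2.1] -/
theorem complexity_fermat_le_log {n k : ℕ} (hk : k ≤ n) (c : ℂ) :
    complexity (∑ i : Fin k, C c * X (Fin.castLE hk i) ^ n : MvPolynomial (Fin n) ℂ) ≤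
      k * (2 * Nat.log 2 n + 2) := by
  calc complexity (∑ i : Fin k, C c * X (Fin.castLE hk i) ^ n : MvPolynomial (Fin n) ℂ)
      ≤ ∑ i : Fin k, complexity (C c * X (Fin.castLE hk i) ^ n : MvPolynomial (Fin n) ℂ) +
          (Finset.univ : Finset (Fin k)).card := complexity_finset_sum_le _ _
    _ ≤ ∑ _i : Fin k, (2 * Nat.log 2 n + 1) + (Finset.univ : Finset (Fin k)).card := by
        gcongr with i
        calc complexity (C c * X (Fin.castLE hk i) ^ n : MvPolynomial (Fin n) ℂ)
            ≤ complexity (C c : MvPolynomial (Fin n) ℂ) +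
                complexity (X (Fin.castLE hk i) ^ n : MvPolynomial (Fin n) ℂ) + 1 :=
              complexity_mul_le_holds _ _
          _ ≤ 0 + (0 + 2 * Nat.log 2 n) + 1 := by
              rw [complexity_C_holds]
              refine Nat.add_le_add_right (Nat.add_le_add_left ?_ _) _
              have h := PartialDerivativeWall.complexity_pow_le_add_two_mul_log
                (X (Fin.castLE hk i) : MvPolynomial (Fin n) ℂ) n
              rwa [complexity_X_holds] at h
          _ = 2 * Nat.log 2 n + 1 := by ring
    _ = k * (2 * Nat.log 2 n + 2) := by
        rw [Finset.sum_const, Finset.card_univ, Fintype.card_fin, smul_eq_mul]; ring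

/-- `2⌊log₂ n⌋ + 2 ≤ n` for `n ≥ 6` (`2^{⌊log₂ n⌋} ≤ n` and `2m + 2 ≤ 2^m` for `m ≥ 3`, the
latter as in `TailFlip.Negative.two_mul_add_two_le_two_pow`). [folklore] -/
theorem two_mul_log_add_two_le {n : ℕ} (hn : 6 ≤ n) : 2 * Nat.log 2 n + 2 ≤ n := by
  have hpow : 2 ^ Nat.log 2 n ≤ n := Nat.pow_log_le_self 2 (by omega)
  rcases lt_or_ge (Nat.log 2 n) 3 with h3 | h3
  · omega
  · have key : ∀ m : ℕ, 3 ≤ m → 2 * m + 2 ≤ 2 ^ m := fun m hm => by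
      induction m, hm using Nat.le_induction with
      | base => norm_num
      | succ m _ ih => rw [pow_succ]; omega
    exact (key _ h3).trans hpow

/-- **The padded Fermat polynomial lies in `SmallCircuits ℂ n 2`** (`n ≥ 6`, `k ≤ n`):
degree `n`, `≤ k(2⌊log₂ n⌋+2) ≤ n²` gates. [cite: ForbesShpilkaVolk2018, Cor. 5] -/
theorem fermat_mem_smallCircuits_two {n k : ℕ} (hn : 6 ≤ n) (hk : k ≤ n) :
    (∑ i : Fin k, C ((n : ℂ)⁻¹) * X (Fin.castLE hk i) ^ n : MvPolynomial (Fin n) ℂ) ∈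
      SmallCircuits ℂ n 2 := by
  refine ⟨totalDegree_fermat_le hk, (complexity_fermat_le_log hk _).trans ?_⟩
  calc k * (2 * Nat.log 2 n + 2) ≤ n * n :=
        Nat.mul_le_mul hk (two_mul_log_add_two_le hn)
    _ = n ^ 2 := (sq n).symm

/-! ## §2 The wall -/

/-- **The degree-method certificates do not vanish on `SmallCircuits ℂ n b`, `b ≥ 2`**: for
`n ≥ 6`, `k ≤ n` some member of `SmallCircuits ℂ n b` (the padded Fermat polynomial) is a non-root
of `certPoly n k`. [cite: BaurStrassen1983] [cite: ForbesShpilkaVolk2018, Def. 1] -/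
theorem certPoly_not_vanish_smallCircuits_two {n k b : ℕ} (hn : 6 ≤ n) (hk : k ≤ n) (hb : 2 ≤ b) :
    ∃ f ∈ SmallCircuits ℂ n b, eval (coeffVector (degLEMonomials n) f) (certPoly n k) ≠ 0 :=
  ⟨_, smallCircuits_mono ℂ hb (by omega) (fermat_mem_smallCircuits_two hn hk),
    eval_certPoly_fermat_ne_zero (by omega) hk⟩

/-- Hence `certPoly n k` is not an `IsNaturalProof` against `SmallCircuits ℂ n b`, `b ≥ 2`, `n ≥ 6`,
`k ≤ n`, in ANY distinguisher class (any level, Boolean sums included). [cite: ForbesShpilkaVolk2018, Def. 1] -/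
theorem not_isNaturalProof_certPoly_two {n k b : ℕ} (hn : 6 ≤ n) (hk : k ≤ n) (hb : 2 ≤ b)
    (𝒟 : Set (MvPolynomial (degLEMonomials n) ℂ)) :
    ¬ IsNaturalProof (degLEMonomials n) (SmallCircuits ℂ n b) 𝒟 (certPoly n k) := by
  rintro ⟨-, -, hvan⟩
  obtain ⟨f, hf, hne⟩ := certPoly_not_vanish_smallCircuits_two hn hk hb
  exact hne (hvan f hf)

/-- **The wall, certificate form**: no polynomial `D` in the coefficient variables (any size, any
degree, Boolean sums included) that is nonzero wherever SOME degree certificate `certPoly n k`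
(`k ≤ n`) is nonzero — the soundness property of the degree method — vanishes on
`SmallCircuits ℂ n b`, `b ≥ 2`, `n ≥ 6`. [cite: ForbesShpilkaVolk2018, Def. 1] -/
theorem no_degreeCertificate_smallCircuits_two {n b : ℕ} (hn : 6 ≤ n) (hb : 2 ≤ b) :
    ¬ ∃ D : MvPolynomial (degLEMonomials n) ℂ,
      (∀ g : MvPolynomial (Fin n) ℂ, g.totalDegree ≤ n →
        (∃ k ≤ n, eval (coeffVector (degLEMonomials n) g) (certPoly n k) ≠ 0) →
        eval (coeffVector (degLEMonomials n) g) D ≠ 0) ∧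
      ∀ f ∈ SmallCircuits ℂ n b, eval (coeffVector (degLEMonomials n) f) D = 0 := by
  rintro ⟨D, hsound, hvan⟩
  obtain ⟨f, hf, hne⟩ := certPoly_not_vanish_smallCircuits_two hn le_rfl hb
  exact hsound f hf.1 ⟨n, le_rfl, hne⟩ (hvan f hf)

/-- **Set form**: the common zero set of the degree certificates `{certPoly n k : k ≤ n}` does not
contain `SmallCircuits ℂ n b`, `b ≥ 2`, `n ≥ 6`. [cite: ForbesShpilkaVolk2018, Def. 1] -/
theorem not_smallCircuits_subset_degreeZeroSet {n b : ℕ} (hn : 6 ≤ n) (hb : 2 ≤ b) :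
    ¬ SmallCircuits ℂ n b ⊆ {g : MvPolynomial (Fin n) ℂ |
        ∀ k ≤ n, eval (coeffVector (degLEMonomials n) g) (certPoly n k) = 0} := by
  intro h
  obtain ⟨f, hf, hne⟩ := certPoly_not_vanish_smallCircuits_two hn le_rfl hb
  exact hne (h hf n le_rfl)

/-! ## §3 The linear-size range of item 18972 with a `b₁ = 2` non-root -/

/-- val-np-p4's `naturalProofsSeparate_linearSize_vp` with the non-root placed in
`SmallCircuits ℂ n 2` (was `3`): for every `c` there are `a = 84c+39` and `n₀` such that for all
`n ≥ n₀` some `D ∈ Distinguishers ℂ n a` is an FSV-natural proof against `{deg ≤ n, L ≤ c·n}` with a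
non-root in `SmallCircuits ℂ n 2`. [cite: BaurStrassen1983] [cite: ForbesShpilkaVolk2018, Def. 1] -/
theorem naturalProofsSeparate_linearSize_vp_two (c : ℕ) :
    ∃ a n₀ : ℕ, ∀ n ≥ n₀, ∃ D : MvPolynomial (degLEMonomials n) ℂ,
      IsNaturalProof (degLEMonomials n)
        {f : MvPolynomial (Fin n) ℂ | f.totalDegree ≤ n ∧ complexity f ≤ c * n}
        (Distinguishers ℂ n a) D ∧
      ∃ g ∈ SmallCircuits ℂ n 2, eval (coeffVector (degLEMonomials n) g) D ≠ 0 := by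
  refine ⟨7 * (12 * c + 4) + 11, 2 ^ (6 * c + 3) + 2, fun n hn => ?_⟩
  have hn' : 2 ^ (6 * c + 3) + 1 ≤ n := by omega
  have h8 : 8 ≤ 2 ^ (6 * c + 3) := by
    calc (8 : ℕ) = 2 ^ 3 := by norm_num
      _ ≤ 2 ^ (6 * c + 3) := Nat.pow_le_pow_right (by norm_num) (by omega)
  have hn3 : 3 ≤ n := by omega
  have hn6 : 6 ≤ n := by omega
  obtain ⟨h1, hkn, hbig, hR⟩ := arith_core c n hn'
  have hB : 2 ≤ (2 * n).choose n := by
    calc 2 = 2 ^ 1 := by norm_num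
      _ ≤ 2 ^ n := Nat.pow_le_pow_right (by norm_num) h1
      _ ≤ (2 * n).choose n :=
          Literature.ModelTheory.FiniteModelTheory.two_pow_le_choose_two_mul_self n
  obtain ⟨hs1, hs2⟩ := size_arith hB hR (card_degLEMonomials_le_choose n)
  refine ⟨certPoly n (kOf c n), ⟨certPoly_mem_distinguishers hs1 hs2, certPoly_ne_zero h1 hkn, ?_⟩,
    ∑ i : Fin (kOf c n), C ((n : ℂ)⁻¹) * X (Fin.castLE hkn i) ^ n,
    fermat_mem_smallCircuits_two hn6 hkn, eval_certPoly_fermat_ne_zero h1 hkn⟩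
  rintro f ⟨hfd, hfs⟩
  exact eval_certPoly_eq_zero (BarrierLever.HBasis.gradientGenericFibreCount _ _ hn3) hbig f hfd hfs

end DegreeMethodWall

end Summit.ValiantsHypothesis.ValiantsHypothesis.Theorems.BarrierLeverDefinableEquations
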